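import Literature.Analysis.FluidPDE.SereginZajaczkowski2007SwirlEnergyTools
import Literature.Analysis.FluidPDE.SereginZajaczkowski2007SwirlProofs
import Literature.Analysis.FluidPDE.SereginZajaczkowski2007L42VorticityEnergy
import Literature.Analysis.FluidPDE.AxisymPoloidalPart
import HarnessLib

/-!
# Seregin–Zajaczkowski 2007, proof of Lemma 4.3: the `L⁴`-energy identity (4.16), proved

G. Seregin, W. Zajaczkowski, *A sufficient condition of regularity for axially symmetric
solutions to the Navier–Stokes equations*, SIAM J. Math. Anal. 39 (2007) 669–685 =
arXiv:math/0702720, §4, proof of Lemma 4.3 (arXiv p. 6). The only unproved leaf under Lemma 4.3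
(and Cor. 4.4, Prop. 4.1) is the `L⁴`-energy bound (4.18), the named fact `SwirlL4EnergyBound`
(`SereginZajaczkowski2007Swirl.lean`). Its printed proof: the swirl equation (4.15) (discharged:
`SwirlEquation_holds`, classical `∂ₜ` in `hasDerivAt_swirl`); "we fix a non-negative smooth and
axially symmetric cut-off function `ψ` […] Then, for `α̃ = V_φψϱ`, we have the following identity
`∂ₜα̃ + V_ϱα̃_{,ϱ} + V₃α̃_{,3} − (α̃_{,ϱϱ} + α̃_{,33} + (1/ϱ)α̃_{,ϱ}) + (2/ϱ)α̃_{,ϱ} = α(∂ₜψ + V_ϱψ_{,ϱ}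
+ V₃ψ_{,3}) − (2α_{,ϱ}ψ_{,ϱ} + 2α_{,3}ψ_{,3} + αψ_{,ϱϱ} + αψ_{,33}) + (1/ϱ)αψ_{,ϱ}`, where `α = V_φϱ`.
Then, we multiply the latter identity by `α̃|α̃|²` and integrate the product by parts over `𝒞̃₁`:
`¼ ∂ₜ ∫_{𝒞̃₁} |α̃|⁴ dx + ¾ ∫_{𝒞̃₁} |∇_a(|α̃|²)|² dx = J₁ + J₂` (4.16)".

This proofs-only file PROVES (4.16) for the hypothesis class of Prop. 4.1
(`IsSmoothAxisymmetricSolutionOn Q̃ V P`, smooth in `x` at the points of `Q̃` only) and every cut-off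
of the printed kind, at each fixed time `-2² < t < 0`, in Cartesian form and as the inequality
that the energy method consumes:

* `SwirlCutoffData ψ C t₀ M` (hypothesis structure, inhabited for every `IsSwirlCutoff ψ` by
  `IsSwirlCutoff.exists_swirlCutoffData`): the compact `C ⊆ 𝒞̃₁` off which `ψ(t, ·)` vanishes, the
  switch-on time `t₀ > -(7/4)²`, and ONE slab constant `M` bounding `‖Dψ‖` and `|Δₓψ|` on
  `[-2², 0] × ℝ³` (the Laplacian of a slice is the value of a space–time continuous function,
  `laplacian_slice_eq_sum`, bounded on the compact `[-2², 0] × C` and zero elsewhere);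
* the slice `f = α̃(t, ·) = ψ(t, ·) Γ(V(t, ·))` is `C^∞` on `ℝ³` with support in `C`
  (`contDiff_alphaTilde`), axially symmetric (`isAxisymmetricScalar_alphaTilde`); product rules
  `Dα̃ = ψDα + αDψ` and `Δα̃ = ψΔα + 2⟪∇ψ,∇α⟫ + αΔψ` at the points of `𝒞̃` (`laplacian_alphaTilde`);
* `l4Density` = the density `∂ₜ(α̃⁴) = 4α̃³(∂ₜψ α + ψ ∂ₜα)` of `SwirlEnergyTools`
  (`hasDerivAt_alphaTilde_pow_four`), and `l4Remainder` = the printed right-hand side of the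
  `α̃`-identity in Cartesian form `α∂ₜψ − 2⟪∇ψ,∇α⟫ − αΔψ + αDψ[V] + (2/ϱ)αDψ[e_ϱ]`; everywhere
  `∂ₜ(α̃⁴) = 4α̃³(Δα̃ − Dα̃[V] − (2/ϱ)Dα̃[e_ϱ]) + 4α̃³ R` (`l4Density_eq`);
* the three integrations by parts of (4.16): `∫ α̃³Δα̃ = −3∫ α̃²|∇α̃|²` (global, `α̃ ∈ C^∞_c`);
  `∫ α̃³ Dα̃[V] = −¼∫ α̃⁴ div V = 0` (local form of the tree's integration by parts, `div V = 0` on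
  `𝒞̃`); `∫ (2/ϱ)α̃³∂_ϱα̃ = 0` (the tree's axis integration by parts
  `integral_two_div_cylRadius_mul_fderiv_eR` with both functions `α̃²`);
* **(4.16)**: `∫ ∂ₜ(α̃⁴) dx = −12 ∫ α̃²|∇α̃|² dx + 4 ∫ α̃³R dx` (`integral_l4Density_eq`) and, since
  `|∇β̃|² = 4α̃²|∇α̃|² ≥ ‖∇ₓβ̃‖²` (`β̃ = α̃²`), the form with the dissipation of (4.18):
  `∫ ∂ₜ(α̃⁴) + 3 ∫ ‖∇ₓβ̃‖² ≤ 4 ∫ α̃³ R` (`integral_l4Density_add_dissipation_le`);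
* the pointwise bound feeding the Hölder–Young estimates of `J₁`, `J₂`: on `C`,
  `|R| ≤ 9M(|α| + ‖∇α‖) + M|α||V^a|` (`abs_l4Remainder_le`; the transport term sees only the
  poloidal part `V^a` because `Dψ[Jx] = 0` for the axially symmetric `ψ`,
  `abs_sliceFDeriv_velocity_le`, `‖V^a‖ = poloidalSpeed`).

No definitions of Props, no named facts; `l4Density`, `l4Remainder` are real-valued helpers.

## References

* G. Seregin, W. Zajaczkowski, SIAM J. Math. Anal. 39 (2007) 669–685, arXiv:math/0702720, §4,
  proof of Lemma 4.3: (4.15), the identity for `α̃`, (4.16) (arXiv p. 6).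
  [`SereginZajaczkowski2007`]
* G. Koch, N. Nadirashvili, G. Seregin, V. Šverák, Acta Math. 203 (2009) 83–105, proof of
  Thm 5.3, (5.19)–(5.20) (the axis integration by parts, accepted
  `integral_two_div_cylRadius_mul_fderiv_eR`). [`KochNadirashviliSereginSverak2009`]
-/

noncomputable section

open MeasureTheory Set Function Filter Topology TopologicalSpace Metric WithLp
open scoped NNReal ENNReal ContDiff InnerProductSpace RealInnerProductSpace Laplacian

namespace Literature.Analysis.FluidPDE

namespace SereginZajaczkowski2007

open SereginSverak2009

/-- Local notation for physical space `ℝ³ = EuclideanSpace ℝ (Fin 3)`. -/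
local notation "ℝ³" => EuclideanSpace ℝ (Fin 3)

/-- Local notation for the standard orthonormal basis of `ℝ³`. -/
local notation "𝐞" => EuclideanSpace.basisFun (Fin 3) ℝ

/-- Local notation: the shell `𝒞̃ = 𝒞(1/4, 3; 2)`. -/
local notation "𝒞" => shell (1 / 4) 3 2

/-- Local notation: the cylinder `Q̃ = 𝒞̃ × ]-2², 0[` as an open set. -/
local notation "Q" => shellCylOpens (1 / 4) 3 2 2

/-- Local notation: the shell `𝒞̃₁ = 𝒞(5/16, 11/4; 7/4)`. -/
local notation "S₁" => shell (5 / 16) (11 / 4) (7 / 4)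

/-! ### The data of a cut-off of the printed kind -/

/-- **The data attached to a cut-off of the class `IsSwirlCutoff`** used by the `L⁴`-energy
method at a fixed time: smoothness, sign and axial symmetry of `ψ`; the compact `C ⊆ 𝒞̃₁` off
which `ψ(t, ·)` vanishes; the time `t₀ > -(7/4)²` before which `ψ` vanishes; and one constant
`M ≥ 0` bounding, on the time slab `[-2², 0]` and at every point, the space–time derivative
`‖Dψ(t, x)‖` (hence `|∂ₜψ|` and `‖∇ₓψ‖`) and the spatial Laplacian `|Δₓψ(t, x)|`. A hypothesis
structure; nothing is asserted (every cut-off of the class admits such data,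
`IsSwirlCutoff.exists_swirlCutoffData`). [folklore] -/
structure SwirlCutoffData (ψ : ℝ × ℝ³ → ℝ) (C : Set ℝ³) (t₀ M : ℝ) : Prop where
  /-- `ψ` is smooth in space–time. -/
  contDiff : ContDiff ℝ ∞ ψ
  /-- `ψ ≥ 0`. -/
  nonneg : ∀ z, 0 ≤ ψ z
  /-- `ψ` is axially symmetric. -/
  axisymmetric : ∀ (θ t : ℝ) (x : ℝ³), ψ (t, rotZ θ x) = ψ (t, x)
  /-- the spatial support set is compact, -/
  isCompact : IsCompact C
  /-- lies in `𝒞̃₁`, -/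
  subset : C ⊆ S₁
  /-- and `ψ(t, ·)` vanishes off it. -/
  zero : ∀ (t : ℝ) (x : ℝ³), x ∉ C → ψ (t, x) = 0
  /-- the switch-on time is later than the bottom of `Q̃₁`, -/
  lt_t₀ : -(7 / 4 : ℝ) ^ 2 < t₀
  /-- and `ψ(t, ·) = 0` for `t ≤ t₀`. -/
  tzero : ∀ t ≤ t₀, ∀ x : ℝ³, ψ (t, x) = 0
  /-- the constant is nonnegative, -/
  M_nonneg : 0 ≤ M
  /-- bounds the space–time derivative on the slab, -/
  norm_fderiv_le : ∀ t ∈ Icc (-(2 : ℝ) ^ 2) 0, ∀ x : ℝ³, ‖fderiv ℝ ψ (t, x)‖ ≤ M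
  /-- and bounds the spatial Laplacian on the slab. -/
  abs_laplacian_le : ∀ t ∈ Icc (-(2 : ℝ) ^ 2) 0, ∀ x : ℝ³, |(Δ fun y => ψ (t, y)) x| ≤ M

section DataConstruction

variable {ψ : ℝ × ℝ³ → ℝ}

/-- The second spatial derivative `∂ᵢ∂ᵢψ(t, ·)(x)` of a slice, as the value at `(t, x)` of a
function continuous in space–time: with `Hᵢ(z) = D(w ↦ Dψ(w)(0, eᵢ))(z)(0, eᵢ)`,
`∂ᵢ∂ᵢψ(t, ·)(x) = Hᵢ(t, x)`. [folklore] -/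
theorem fderiv_fderiv_slice_apply (hψ : ContDiff ℝ ∞ ψ) (t : ℝ) (x : ℝ³) (v : ℝ³) :
    fderiv ℝ (fun y => fderiv ℝ (fun y => ψ (t, y)) y v) x v =
      fderiv ℝ (fun w => fderiv ℝ ψ w ((0 : ℝ), v)) (t, x) ((0 : ℝ), v) := by
  have hd : Differentiable ℝ ψ := hψ.differentiable (by simp)
  -- the first derivative of the slice, everywhere
  have h1 : (fun y => fderiv ℝ (fun y => ψ (t, y)) y v) =
      fun y => fderiv ℝ ψ (t, y) ((0 : ℝ), v) := by
    funext y
    rw [(hasFDerivAt_slice hψ t y).fderiv, sliceFDeriv, ContinuousLinearMap.comp_apply,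
      ContinuousLinearMap.inr_apply]
  rw [h1]
  -- the second: chain rule through `y ↦ (t, y)`
  have hG : DifferentiableAt ℝ (fun w => fderiv ℝ ψ w ((0 : ℝ), v)) (t, x) :=
    (((hψ.fderiv_right (m := 1) (by norm_cast)).clm_apply contDiff_const).differentiable
      one_ne_zero) (t, x)
  have hcomp : HasFDerivAt (fun y : ℝ³ => fderiv ℝ ψ (t, y) ((0 : ℝ), v))
      ((fderiv ℝ (fun w => fderiv ℝ ψ w ((0 : ℝ), v)) (t, x)).comp
        (ContinuousLinearMap.inr ℝ ℝ ℝ³)) x :=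
    hG.hasFDerivAt.comp x (hasFDerivAt_prodMk_right t x)
  rw [hcomp.fderiv, ContinuousLinearMap.comp_apply, ContinuousLinearMap.inr_apply]

/-- The slices of a smooth space–time function are smooth. [folklore] -/
theorem contDiff_slice' (hψ : ContDiff ℝ ∞ ψ) (t : ℝ) {n : ℕ∞} :
    ContDiff ℝ n fun y => ψ (t, y) :=
  (hψ.of_le (by exact_mod_cast le_top)).comp (contDiff_prodMk_right t)

/-- The Laplacian of a slice as a sum of values of space–time continuous functions:
`Δψ(t, ·)(x) = Σᵢ Hᵢ(t, x)`. [folklore] -/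
theorem laplacian_slice_eq_sum (hψ : ContDiff ℝ ∞ ψ) (t : ℝ) (x : ℝ³) :
    (Δ fun y => ψ (t, y)) x =
      ∑ i, fderiv ℝ (fun w => fderiv ℝ ψ w ((0 : ℝ), 𝐞 i)) (t, x) ((0 : ℝ), 𝐞 i) := by
  rw [laplacian_eq_sum_of_contDiffAt ((contDiff_slice' hψ t).contDiffAt)]
  exact Finset.sum_congr rfl fun i _ => fderiv_fderiv_slice_apply hψ t x (𝐞 i)

/-- If `ψ(t, x) = 0` whenever `x ∉ C`, `C` closed, then `w ↦ Dψ(w)(0, v)` vanishes on the open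
set `ℝ × Cᶜ`, and so does its derivative. [folklore] -/
theorem fderiv_fderiv_eq_zero_of_notMem {C : Set ℝ³} (hC : IsClosed C)
    (hzero : ∀ (t : ℝ) (x : ℝ³), x ∉ C → ψ (t, x) = 0) {t : ℝ} {x : ℝ³} (hx : x ∉ C) (v : ℝ³) :
    fderiv ℝ (fun w => fderiv ℝ ψ w ((0 : ℝ), v)) (t, x) ((0 : ℝ), v) = 0 := by
  have hU : (univ : Set ℝ) ×ˢ Cᶜ ∈ 𝓝 ((t, x) : ℝ × ℝ³) :=
    (isOpen_univ.prod hC.isOpen_compl).mem_nhds ⟨mem_univ _, hx⟩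
  have h0 : (fun w : ℝ × ℝ³ => fderiv ℝ ψ w ((0 : ℝ), v)) =ᶠ[𝓝 (t, x)] fun _ => 0 := by
    filter_upwards [hU] with w hw
    have hw0 : fderiv ℝ ψ w = 0 := by
      refine fderiv_of_notMem_tsupport ℝ (notMem_tsupport_iff_eventuallyEq.2 ?_)
      have hU' : (univ : Set ℝ) ×ˢ Cᶜ ∈ 𝓝 w :=
        (isOpen_univ.prod hC.isOpen_compl).mem_nhds hw
      filter_upwards [hU'] with w' hw'
      exact hzero w'.1 w'.2 hw'.2
    rw [hw0, _root_.zero_apply]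
  rw [h0.fderiv_eq, fderiv_const_apply, _root_.zero_apply]

/-- **Every cut-off of the printed kind admits cut-off data.** [folklore] -/
theorem IsSwirlCutoff.exists_swirlCutoffData (hψ : IsSwirlCutoff ψ) :
    ∃ (C : Set ℝ³) (t₀ M : ℝ), SwirlCutoffData ψ C t₀ M := by
  obtain ⟨C, hCc, hCsub, hC0⟩ := hψ.space_support
  obtain ⟨t₀, ht₀, ht0⟩ := hψ.time_support
  -- bound for `‖Dψ‖` on the slab (zero off `C`)
  have hd1 : ContDiff ℝ 1 (uncurry fun t x => ψ (t, x)) := hψ.contDiff.of_le (by simp)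
  obtain ⟨M₁, hM₁0, hM₁⟩ := exists_norm_fderiv_uncurry_le (Ψ := fun t x => ψ (t, x)) hd1 hCc
    (fun t x hx => hC0 t x hx) (-(2 : ℝ) ^ 2) 0
  -- bound for the Laplacian of the slices: each `Hᵢ` is continuous, bounded on `[-4,0] × C`
  set H : Fin 3 → ℝ × ℝ³ → ℝ := fun i w =>
    fderiv ℝ (fun w => fderiv ℝ ψ w ((0 : ℝ), 𝐞 i)) w ((0 : ℝ), 𝐞 i) with hH_def
  have hHc : ∀ i, Continuous (H i) := by
    intro i
    have h1 : ContDiff ℝ 1 fun w => fderiv ℝ ψ w ((0 : ℝ), 𝐞 i) :=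
      (hψ.contDiff.fderiv_right (m := 1) (by norm_cast)).clm_apply contDiff_const
    exact (h1.continuous_fderiv one_ne_zero).clm_apply continuous_const
  have hbd : ∀ i, ∃ B : ℝ, ∀ w ∈ Icc (-(2 : ℝ) ^ 2) 0 ×ˢ C, ‖H i w‖ ≤ B := fun i =>
    (isCompact_Icc.prod hCc).exists_bound_of_continuousOn (hHc i).continuousOn
  choose B hB using hbd
  set M₂ : ℝ := ∑ i, max (B i) 0 with hM₂_def
  have hM₂0 : 0 ≤ M₂ := Finset.sum_nonneg fun i _ => le_max_right _ _
  have hLap : ∀ t ∈ Icc (-(2 : ℝ) ^ 2) 0, ∀ x : ℝ³, |(Δ fun y => ψ (t, y)) x| ≤ M₂ := by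
    intro t ht x
    rw [laplacian_slice_eq_sum hψ.contDiff t x]
    refine (Finset.abs_sum_le_sum_abs _ _).trans (Finset.sum_le_sum fun i _ => ?_)
    by_cases hx : x ∈ C
    · have h := hB i (t, x) ⟨ht, hx⟩
      rw [Real.norm_eq_abs] at h
      exact h.trans (le_max_left _ _)
    · rw [fderiv_fderiv_eq_zero_of_notMem hCc.isClosed hC0 hx, abs_zero]
      exact le_max_right _ _
  refine ⟨C, t₀, max M₁ M₂, ?_⟩
  exact
    { contDiff := hψ.contDiff
      nonneg := hψ.nonneg
      axisymmetric := hψ.axisymmetric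
      isCompact := hCc
      subset := hCsub
      zero := hC0
      lt_t₀ := ht₀
      tzero := ht0
      M_nonneg := hM₁0.trans (le_max_left _ _)
      norm_fderiv_le := fun t ht x => (hM₁ t ht x).trans (le_max_left _ _)
      abs_laplacian_le := fun t ht x => (hLap t ht x).trans (le_max_right _ _) }

end DataConstruction

/-! ### The slice `f = α̃(t, ·)` and its derivatives -/

section Slice

variable {ψ : ℝ × ℝ³ → ℝ} {C : Set ℝ³} {t₀ M : ℝ}
variable {V : ℝ → ℝ³ → ℝ³} {P : ℝ → ℝ³ → ℝ}

/-- `α̃(t, ·)` unfolded as a cut-off product. [folklore] -/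
theorem alphaTilde_eq_fun (ψ : ℝ × ℝ³ → ℝ) (V : ℝ → ℝ³ → ℝ³) (t : ℝ) :
    alphaTilde ψ V t = fun y => ψ (t, y) * swirl (V t) y := rfl

/-- The spatial derivative of a slice of `ψ` is `sliceFDeriv`. [folklore] -/
theorem fderiv_slice_eq_sliceFDeriv (hψ : ContDiff ℝ ∞ ψ) (t : ℝ) (x : ℝ³) :
    fderiv ℝ (fun y => ψ (t, y)) x = sliceFDeriv ψ (t, x) :=
  (hasFDerivAt_slice hψ t x).fderiv

/-- `‖sliceFDeriv ψ z‖ ≤ ‖Dψ(z)‖`. [folklore] -/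
theorem norm_sliceFDeriv_le_norm_fderiv (ψ : ℝ × ℝ³ → ℝ) (z : ℝ × ℝ³) :
    ‖sliceFDeriv ψ z‖ ≤ ‖fderiv ℝ ψ z‖ := by
  refine ContinuousLinearMap.opNorm_le_bound _ (norm_nonneg _) fun v => ?_
  rw [sliceFDeriv, ContinuousLinearMap.comp_apply, ContinuousLinearMap.inr_apply]
  refine ((fderiv ℝ ψ z).le_opNorm _).trans ?_
  gcongr
  simp [Prod.norm_def]

/-- `|∂ₜψ(z)| = |Dψ(z)(1, 0)| ≤ ‖Dψ(z)‖`. [folklore] -/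
theorem abs_fderiv_one_zero_le_norm_fderiv (ψ : ℝ × ℝ³ → ℝ) (z : ℝ × ℝ³) :
    |fderiv ℝ ψ z ((1 : ℝ), (0 : ℝ³))| ≤ ‖fderiv ℝ ψ z‖ := by
  rw [← Real.norm_eq_abs]
  refine ((fderiv ℝ ψ z).le_opNorm _).trans ?_
  have : ‖((1 : ℝ), (0 : ℝ³))‖ = 1 := by simp [Prod.norm_def]
  rw [this, mul_one]

namespace SwirlCutoffData

variable (d : SwirlCutoffData ψ C t₀ M)
include d

/-- `C ⊆ 𝒞̃`. [folklore] -/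
theorem subset_shell : C ⊆ 𝒞 := d.subset.trans shell_one_subset_tilde

/-- The slices of `ψ` are axially symmetric scalars. [folklore] -/
theorem isAxisymmetricScalar_slice (t : ℝ) : IsAxisymmetricScalar fun y => ψ (t, y) :=
  fun θ x => d.axisymmetric θ t x

/-- `tsupport ψ(t, ·) ⊆ C`. [folklore] -/
theorem tsupport_slice_subset' (t : ℝ) : tsupport (fun y => ψ (t, y)) ⊆ C :=
  closure_minimal (fun x hx => by_contra fun h => hx (d.zero t x h)) d.isCompact.isClosed

/-- `tsupport ψ(t, ·) ⊆ 𝒞̃`. [folklore] -/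
theorem tsupport_slice_subset_shell (t : ℝ) : tsupport (fun y => ψ (t, y)) ⊆ 𝒞 :=
  (d.tsupport_slice_subset' t).trans d.subset_shell

/-- `α̃(t, x) = 0` for `x ∉ C`. [folklore] -/
theorem alphaTilde_eq_zero (V : ℝ → ℝ³ → ℝ³) (t : ℝ) {x : ℝ³} (hx : x ∉ C) :
    alphaTilde ψ V t x = 0 := by
  rw [alphaTilde, d.zero t x hx, zero_mul]

/-- `tsupport α̃(t, ·) ⊆ C`. [folklore] -/
theorem tsupport_alphaTilde_subset (V : ℝ → ℝ³ → ℝ³) (t : ℝ) :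
    tsupport (alphaTilde ψ V t) ⊆ C :=
  closure_minimal (fun _ hx => by_contra fun h => hx (d.alphaTilde_eq_zero V t h))
    d.isCompact.isClosed

/-- `tsupport α̃(t, ·) ⊆ 𝒞̃`. [folklore] -/
theorem tsupport_alphaTilde_subset_shell (V : ℝ → ℝ³ → ℝ³) (t : ℝ) :
    tsupport (alphaTilde ψ V t) ⊆ 𝒞 :=
  (d.tsupport_alphaTilde_subset V t).trans d.subset_shell

/-- `α̃(t, ·)` has compact support. [folklore] -/
theorem hasCompactSupport_alphaTilde (V : ℝ → ℝ³ → ℝ³) (t : ℝ) :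
    HasCompactSupport (alphaTilde ψ V t) :=
  HasCompactSupport.intro d.isCompact fun _ hx => d.alphaTilde_eq_zero V t hx

/-- **`α̃(t, ·)` is smooth on `ℝ³`** for `-2² < t < 0` (smooth at the points of `𝒞̃`, zero near
every other point). [folklore] -/
theorem contDiff_alphaTilde (hV : IsSmoothAxisymmetricSolutionOn Q V P) {t : ℝ}
    (ht : t ∈ Ioo (-(2 : ℝ) ^ 2) 0) {n : ℕ∞} : ContDiff ℝ n (alphaTilde ψ V t) := by
  rw [alphaTilde_eq_fun]
  exact contDiff_mul_of_tsupport_subset (contDiff_slice' d.contDiff t)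
    (d.tsupport_slice_subset_shell t) fun x hx => (hV.contDiffAt_swirl (mk_mem_Q ht hx)).of_le
      (by exact_mod_cast le_top)

/-- Powers of `α̃(t, ·)` are `C¹` with compact support inside `C`. [folklore] -/
theorem contDiff_alphaTilde_pow (hV : IsSmoothAxisymmetricSolutionOn Q V P) {t : ℝ}
    (ht : t ∈ Ioo (-(2 : ℝ) ^ 2) 0) (n : ℕ) : ContDiff ℝ 1 fun y => alphaTilde ψ V t y ^ n :=
  (d.contDiff_alphaTilde hV ht (n := 1)).pow n

/-- `tsupport (α̃(t, ·)ⁿ) ⊆ C` for `n ≠ 0`. [folklore] -/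
theorem tsupport_alphaTilde_pow_subset (V : ℝ → ℝ³ → ℝ³) (t : ℝ) {n : ℕ} (hn : n ≠ 0) :
    tsupport (fun y => alphaTilde ψ V t y ^ n) ⊆ C :=
  closure_minimal (fun x hx => by_contra fun h => hx (by
    simp [d.alphaTilde_eq_zero V t h, hn])) d.isCompact.isClosed

/-- `α̃(t, ·)ⁿ` has compact support. [folklore] -/
theorem hasCompactSupport_alphaTilde_pow (V : ℝ → ℝ³ → ℝ³) (t : ℝ) {n : ℕ} (hn : n ≠ 0) :
    HasCompactSupport fun y => alphaTilde ψ V t y ^ n :=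
  HasCompactSupport.intro d.isCompact fun _ hx => by simp [d.alphaTilde_eq_zero V t hx, hn]

/-- The slab bound for the time derivative of the cut-off: `|∂ₜψ(t, x)| ≤ M`. [folklore] -/
theorem abs_timeDeriv_le {t : ℝ} (ht : t ∈ Icc (-(2 : ℝ) ^ 2) 0) (x : ℝ³) :
    |fderiv ℝ ψ (t, x) ((1 : ℝ), (0 : ℝ³))| ≤ M :=
  (abs_fderiv_one_zero_le_norm_fderiv ψ (t, x)).trans (d.norm_fderiv_le t ht x)

/-- The slab bound for the spatial derivative of the cut-off: `‖∇ₓψ(t, x)‖ ≤ M`. [folklore] -/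
theorem norm_sliceFDeriv_le {t : ℝ} (ht : t ∈ Icc (-(2 : ℝ) ^ 2) 0) (x : ℝ³) :
    ‖sliceFDeriv ψ (t, x)‖ ≤ M :=
  (norm_sliceFDeriv_le_norm_fderiv ψ (t, x)).trans (d.norm_fderiv_le t ht x)

/-- **Product rule for `α̃ = ψ α`** at a point of `𝒞̃`:
`Dα̃ e = ψ Dα e + α Dψ e`. [folklore] -/
theorem fderiv_alphaTilde_apply (hV : IsSmoothAxisymmetricSolutionOn Q V P) {t : ℝ}
    (ht : t ∈ Ioo (-(2 : ℝ) ^ 2) 0) {x : ℝ³} (hx : x ∈ 𝒞) (e : ℝ³) :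
    fderiv ℝ (alphaTilde ψ V t) x e =
      ψ (t, x) * fderiv ℝ (swirl (V t)) x e + swirl (V t) x * sliceFDeriv ψ (t, x) e := by
  rw [alphaTilde_eq_fun, fderiv_mul_apply_of_differentiableAt
    ((contDiff_slice' d.contDiff t (n := 1)).differentiable one_ne_zero x)
    (differentiableAt_swirl (hV.differentiableAt (mk_mem_Q ht hx))),
    fderiv_slice_eq_sliceFDeriv d.contDiff]
  ring

/-- **Product rule for the Laplacian of `α̃ = ψ α`** at a point of `𝒞̃`:
`Δα̃ = ψ Δα + 2 Σᵢ ∂ᵢψ ∂ᵢα + α Δψ`. [folklore] -/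
theorem laplacian_alphaTilde (hV : IsSmoothAxisymmetricSolutionOn Q V P) {t : ℝ}
    (ht : t ∈ Ioo (-(2 : ℝ) ^ 2) 0) {x : ℝ³} (hx : x ∈ 𝒞) :
    (Δ (alphaTilde ψ V t)) x =
      ψ (t, x) * (Δ (swirl (V t))) x +
        2 * ∑ i, sliceFDeriv ψ (t, x) (𝐞 i) * fderiv ℝ (swirl (V t)) x (𝐞 i) +
        swirl (V t) x * (Δ fun y => ψ (t, y)) x := by
  set Ψ : ℝ³ → ℝ := fun y => ψ (t, y) with hΨ_def
  set α : ℝ³ → ℝ := swirl (V t) with hα_def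
  have hΨs : ContDiff ℝ ∞ Ψ := contDiff_slice' d.contDiff t
  have hΨd : Differentiable ℝ Ψ := hΨs.differentiable (by simp)
  have hΨ2 : ∀ i, Differentiable ℝ fun y => fderiv ℝ Ψ y (𝐞 i) := fun i =>
    ((hΨs.fderiv_right (m := 1) (by norm_cast)).clm_apply contDiff_const).differentiable
      one_ne_zero
  have hαx : ContDiffAt ℝ ∞ α x := hV.contDiffAt_swirl (mk_mem_Q ht hx)
  have hαd : ∀ y ∈ 𝒞, DifferentiableAt ℝ α y := fun y hy =>
    differentiableAt_swirl (hV.differentiableAt (mk_mem_Q ht hy))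
  have hα2 : ∀ i, DifferentiableAt ℝ (fun y => fderiv ℝ α y (𝐞 i)) x := fun i =>
    hV.differentiableAt_fderiv_swirl_apply (𝐞 i) (mk_mem_Q ht hx)
  have hf2 : ContDiffAt ℝ 2 (alphaTilde ψ V t) x :=
    (d.contDiff_alphaTilde hV ht (n := 2)).contDiffAt
  -- the first derivatives near `x`
  have hnear : ∀ i, (fun y => fderiv ℝ (alphaTilde ψ V t) y (𝐞 i)) =ᶠ[𝓝 x]
      fun y => fderiv ℝ Ψ y (𝐞 i) * α y + Ψ y * fderiv ℝ α y (𝐞 i) := by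
    intro i
    filter_upwards [(isOpen_shell _ _ _).mem_nhds hx] with y hy
    rw [alphaTilde_eq_fun, fderiv_mul_apply_of_differentiableAt (hΨd y) (hαd y hy)]
  -- the second derivatives at `x`
  have hsecond : ∀ i, fderiv ℝ (fun y => fderiv ℝ (alphaTilde ψ V t) y (𝐞 i)) x (𝐞 i) =
      fderiv ℝ (fun y => fderiv ℝ Ψ y (𝐞 i)) x (𝐞 i) * α x +
        2 * (fderiv ℝ Ψ x (𝐞 i) * fderiv ℝ α x (𝐞 i)) +
        Ψ x * fderiv ℝ (fun y => fderiv ℝ α y (𝐞 i)) x (𝐞 i) := by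
    intro i
    rw [(hnear i).fderiv_eq]
    rw [fderiv_fun_add ((hΨ2 i x).fun_mul (hαd x hx)) ((hΨd x).fun_mul (hα2 i))]
    rw [_root_.add_apply, fderiv_mul_apply_of_differentiableAt (hΨ2 i x) (hαd x hx),
      fderiv_mul_apply_of_differentiableAt (hΨd x) (hα2 i)]
    ring
  rw [laplacian_eq_sum_of_contDiffAt hf2, laplacian_eq_sum_of_contDiffAt (hαx.of_le (by norm_cast)),
    laplacian_eq_sum_of_contDiffAt (hΨs.contDiffAt.of_le (by norm_cast))]
  simp_rw [hsecond]
  have hsl : ∀ i, fderiv ℝ Ψ x (𝐞 i) = sliceFDeriv ψ (t, x) (𝐞 i) := fun i => by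
    rw [hΨ_def, fderiv_slice_eq_sliceFDeriv d.contDiff]
  simp_rw [hsl]
  rw [Finset.mul_sum, Finset.mul_sum, Finset.mul_sum, ← Finset.sum_add_distrib,
    ← Finset.sum_add_distrib]
  refine Finset.sum_congr rfl fun i _ => ?_
  simp only [hΨ_def, hα_def]
  ring

end SwirlCutoffData

end Slice

/-! ### The density `∂ₜ(α̃⁴)` and the remainder of the `α̃`-identity -/

/-- **The density `∂ₜ(|α̃|⁴)` of `¼ ∂ₜ ∫ |α̃|⁴ dx`** in (4.16):
`4 α̃³ (∂ₜψ α + ψ ∂ₜα)` with `∂ₜα = Δα − Dα[V] − (2/ϱ)∂_ϱα` from the swirl equation (4.15)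
(`hasDerivAt_alphaTilde_pow_four`). [cite: SereginZajaczkowski2007, proof of Lemma 4.3, (4.15)–(4.16)] -/
def l4Density (ψ : ℝ × ℝ³ → ℝ) (V : ℝ → ℝ³ → ℝ³) (t : ℝ) (x : ℝ³) : ℝ :=
  4 * alphaTilde ψ V t x ^ 3 *
    (fderiv ℝ ψ (t, x) ((1 : ℝ), (0 : ℝ³)) * swirl (V t) x +
      ψ (t, x) * ((Δ (swirl (V t))) x - fderiv ℝ (swirl (V t)) x (V t x) -
        2 / cylRadius x * partialDeriv (eR x) (swirl (V t)) x))

/-- **The right-hand side of the identity for `α̃`** (Seregin–Zajaczkowski 2007, proof of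
Lemma 4.3: "for `α̃ = V_φψϱ`, we have the following identity
`∂ₜα̃ + V_ϱα̃_{,ϱ} + V₃α̃_{,3} − (α̃_{,ϱϱ} + α̃_{,33} + (1/ϱ)α̃_{,ϱ}) + (2/ϱ)α̃_{,ϱ}
  = α(∂ₜψ + V_ϱψ_{,ϱ} + V₃ψ_{,3}) − (2α_{,ϱ}ψ_{,ϱ} + 2α_{,3}ψ_{,3} + αψ_{,ϱϱ} + αψ_{,33}) + (1/ϱ)αψ_{,ϱ}`,
where `α = V_φϱ`"), in Cartesian form: `α ∂ₜψ − 2⟪∇ψ, ∇α⟫ − α Δψ + α Dψ[V] + (2/ϱ) α Dψ[e_ϱ]`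
(the printed `−α(ψ_{,ϱϱ} + ψ_{,33}) + (1/ϱ)αψ_{,ϱ}` is `−αΔψ + (2/ϱ)αψ_{,ϱ}`). It is the integrand
of `J₁ + J₂` in (4.16) after multiplication by `α̃|α̃|²`.
[cite: SereginZajaczkowski2007, proof of Lemma 4.3 (the identity for α̃)] -/
def l4Remainder (ψ : ℝ × ℝ³ → ℝ) (V : ℝ → ℝ³ → ℝ³) (t : ℝ) (x : ℝ³) : ℝ :=
  swirl (V t) x * fderiv ℝ ψ (t, x) ((1 : ℝ), (0 : ℝ³)) -
      2 * ∑ i, sliceFDeriv ψ (t, x) (𝐞 i) * fderiv ℝ (swirl (V t)) x (𝐞 i) -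
      swirl (V t) x * (Δ fun y => ψ (t, y)) x +
      swirl (V t) x * sliceFDeriv ψ (t, x) (V t x) +
      2 / cylRadius x * (swirl (V t) x * sliceFDeriv ψ (t, x) (eR x))

section Identity

variable {ψ : ℝ × ℝ³ → ℝ} {C : Set ℝ³} {t₀ M : ℝ}
variable {V : ℝ → ℝ³ → ℝ³} {P : ℝ → ℝ³ → ℝ}

/-- The density is the time derivative of `α̃⁴` at the points of `𝒞̃`. [folklore] -/
theorem hasDerivAt_alphaTilde_pow_four_l4Density (hψ : ContDiff ℝ ∞ ψ)
    (hV : IsSmoothAxisymmetricSolutionOn Q V P) {x : ℝ³} (hx : x ∈ 𝒞) {t : ℝ}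
    (ht : t ∈ Ioo (-(2 : ℝ) ^ 2) 0) :
    HasDerivAt (fun r => alphaTilde ψ V r x ^ 4) (l4Density ψ V t x) t :=
  hasDerivAt_alphaTilde_pow_four hψ hV hx ht

/-- The derivative of a power of a real function along a vector:
`D(fⁿ)(x) v = n f(x)ⁿ⁻¹ Df(x) v`. [folklore] -/
theorem fderiv_pow_apply_eq {f : ℝ³ → ℝ} {x : ℝ³} (hf : DifferentiableAt ℝ f x) (n : ℕ)
    (v : ℝ³) : fderiv ℝ (fun y => f y ^ n) x v = n * f x ^ (n - 1) * fderiv ℝ f x v := by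
  rw [(hf.hasFDerivAt.pow n).fderiv]
  simp [smul_eq_mul]

/-- Expansion of a functional along the standard basis: `L v = Σᵢ vᵢ L eᵢ`. [folklore] -/
theorem fderiv_apply_eq_sum_clm (L : ℝ³ →L[ℝ] ℝ) (v : ℝ³) : L v = ∑ i, v i * L (𝐞 i) := by
  have h := fderiv_apply_eq_sum (fun y : ℝ³ => L y) 0 v
  rwa [L.fderiv] at h

/-- For a real functional on `ℝ³`, `‖L‖² ≤ Σᵢ (L eᵢ)²` (Cauchy–Schwarz in coordinates).
[folklore] -/
theorem opNorm_sq_le_sum_sq (L : ℝ³ →L[ℝ] ℝ) : ‖L‖ ^ 2 ≤ ∑ i, L (𝐞 i) ^ 2 := by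
  have hS0 : 0 ≤ ∑ i, L (𝐞 i) ^ 2 := Finset.sum_nonneg fun i _ => sq_nonneg _
  have hle : ‖L‖ ≤ Real.sqrt (∑ i, L (𝐞 i) ^ 2) := by
    refine ContinuousLinearMap.opNorm_le_bound _ (Real.sqrt_nonneg _) fun v => ?_
    have hv : L v = ∑ i, v i * L (𝐞 i) := fderiv_apply_eq_sum_clm L v
    rw [hv, Real.norm_eq_abs]
    have hcs := Real.sum_mul_le_sqrt_mul_sqrt Finset.univ (fun i => v i) (fun i => L (𝐞 i))
    have hcs' := Real.sum_mul_le_sqrt_mul_sqrt Finset.univ (fun i => -v i) (fun i => L (𝐞 i))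
    have hn : Real.sqrt (∑ i, v i ^ 2) = ‖v‖ := by
      rw [← norm_sq_eq_sum_sq v, Real.sqrt_sq (norm_nonneg _)]
    have hn' : Real.sqrt (∑ i, (-v i) ^ 2) = ‖v‖ := by
      simp only [even_two, Even.neg_pow]
      exact hn
    simp only [neg_mul, Finset.sum_neg_distrib] at hcs'
    rw [hn] at hcs
    rw [hn'] at hcs'
    rw [mul_comm]
    exact abs_le.2 ⟨by linarith, hcs⟩
  calc ‖L‖ ^ 2 ≤ Real.sqrt (∑ i, L (𝐞 i) ^ 2) ^ 2 := pow_le_pow_left₀ (norm_nonneg _) hle 2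
    _ = ∑ i, L (𝐞 i) ^ 2 := Real.sq_sqrt hS0

namespace SwirlCutoffData

variable (d : SwirlCutoffData ψ C t₀ M)
include d

/-- **The density rewritten with the `α̃`-identity**: everywhere on `ℝ³`,
`∂ₜ(α̃⁴) = 4α̃³ (Δα̃ − Dα̃[V] − (2/ϱ) Dα̃[e_ϱ]) + 4α̃³ R`, `R = l4Remainder` (at the points of `𝒞̃`
by the product rules for `α̃ = ψα`; elsewhere both sides vanish).
[cite: SereginZajaczkowski2007, proof of Lemma 4.3 (the identity for α̃)] -/
theorem l4Density_eq (hV : IsSmoothAxisymmetricSolutionOn Q V P) {t : ℝ}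
    (ht : t ∈ Ioo (-(2 : ℝ) ^ 2) 0) (x : ℝ³) :
    l4Density ψ V t x =
      4 * alphaTilde ψ V t x ^ 3 *
          ((Δ (alphaTilde ψ V t)) x - fderiv ℝ (alphaTilde ψ V t) x (V t x) -
            2 / cylRadius x * fderiv ℝ (alphaTilde ψ V t) x (eR x)) +
        4 * alphaTilde ψ V t x ^ 3 * l4Remainder ψ V t x := by
  by_cases hx : x ∈ 𝒞
  · rw [l4Density, l4Remainder, d.laplacian_alphaTilde hV ht hx,
      d.fderiv_alphaTilde_apply hV ht hx, d.fderiv_alphaTilde_apply hV ht hx, partialDeriv_apply,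
      alphaTilde]
    ring
  · have h0 : alphaTilde ψ V t x = 0 :=
      d.alphaTilde_eq_zero V t fun h => hx (d.subset_shell h)
    simp [l4Density, h0]

/-- **First integration by parts**: `∫ α̃³ Δα̃ = −3 ∫ α̃² |∇α̃|²` (`α̃(t, ·) ∈ C^∞_c`).
[cite: SereginZajaczkowski2007, proof of Lemma 4.3, (4.16) (the term ¾∫|∇_a(|α̃|²)|²)] -/
theorem integral_pow_three_mul_laplacian (hV : IsSmoothAxisymmetricSolutionOn Q V P) {t : ℝ}
    (ht : t ∈ Ioo (-(2 : ℝ) ^ 2) 0) :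
    ∫ x, alphaTilde ψ V t x ^ 3 * (Δ (alphaTilde ψ V t)) x =
      -3 * ∫ x, alphaTilde ψ V t x ^ 2 * ∑ i, (fderiv ℝ (alphaTilde ψ V t) x (𝐞 i)) ^ 2 := by
  set f : ℝ³ → ℝ := alphaTilde ψ V t with hf_def
  have hfs : ContDiff ℝ ∞ f := d.contDiff_alphaTilde hV ht
  have hfd : Differentiable ℝ f := hfs.differentiable (by simp)
  have hfc : Continuous f := hfs.continuous
  -- the partial derivatives `g i = ∂ᵢ f` are smooth
  have hg : ∀ i, ContDiff ℝ ∞ fun y => fderiv ℝ f y (𝐞 i) := fun i =>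
    (hfs.fderiv_right (m := ∞) (by norm_cast)).clm_apply contDiff_const
  have hgc : ∀ i, Continuous fun y => fderiv ℝ f y (𝐞 i) := fun i => (hg i).continuous
  have hg'c : ∀ i, Continuous fun y => fderiv ℝ (fun y => fderiv ℝ f y (𝐞 i)) y (𝐞 i) := fun i =>
    ((hg i).continuous_fderiv (by simp)).clm_apply continuous_const
  have hlap : ∀ x, (Δ f) x = ∑ i, fderiv ℝ (fun y => fderiv ℝ f y (𝐞 i)) x (𝐞 i) := fun x =>
    laplacian_eq_sum_of_contDiffAt ((hfs.of_le (by norm_cast)).contDiffAt)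
  have hf3 : ContDiff ℝ 1 fun y => f y ^ 3 := (hfs.of_le (by norm_cast)).pow 3
  have hcpt3 : HasCompactSupport fun y => f y ^ 3 :=
    d.hasCompactSupport_alphaTilde_pow V t three_ne_zero
  have hcpt2 : HasCompactSupport fun y => f y ^ 2 :=
    d.hasCompactSupport_alphaTilde_pow V t two_ne_zero
  -- integration by parts for each `i`
  have hIBP : ∀ i, ∫ x, f x ^ 3 * fderiv ℝ (fun y => fderiv ℝ f y (𝐞 i)) x (𝐞 i) =
      -∫ x, 3 * (f x ^ 2 * fderiv ℝ f x (𝐞 i) ^ 2) := by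
    intro i
    rw [integral_mul_fderiv_apply_eq_neg_of_tsupport_subset isOpen_univ hf3 hcpt3
      (subset_univ _) (fun x _ => (hg i).differentiable (by simp) x) (hgc i).continuousOn (𝐞 i)
      (hg'c i).continuousOn]
    congr 1
    refine integral_congr_ae (Eventually.of_forall fun x => ?_)
    show fderiv ℝ (fun y => f y ^ 3) x (𝐞 i) * fderiv ℝ f x (𝐞 i) =
      3 * (f x ^ 2 * fderiv ℝ f x (𝐞 i) ^ 2)
    rw [fderiv_pow_apply_eq (hfd x) 3]
    ring
  -- integrability of the summands
  have hint1 : ∀ i, Integrable fun x => f x ^ 3 * fderiv ℝ (fun y => fderiv ℝ f y (𝐞 i)) x (𝐞 i) :=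
    fun i => ((hfc.pow 3).mul (hg'c i)).integrable_of_hasCompactSupport hcpt3.mul_right
  have hint2 : ∀ i, Integrable fun x => f x ^ 2 * fderiv ℝ f x (𝐞 i) ^ 2 :=
    fun i => ((hfc.pow 2).mul ((hgc i).pow 2)).integrable_of_hasCompactSupport hcpt2.mul_right
  calc ∫ x, f x ^ 3 * (Δ f) x
      = ∫ x, ∑ i, f x ^ 3 * fderiv ℝ (fun y => fderiv ℝ f y (𝐞 i)) x (𝐞 i) := by
        refine integral_congr_ae (Eventually.of_forall fun x => ?_)
        show f x ^ 3 * (Δ f) x = ∑ i, f x ^ 3 * fderiv ℝ (fun y => fderiv ℝ f y (𝐞 i)) x (𝐞 i)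
        rw [hlap x, Finset.mul_sum]
    _ = ∑ i, ∫ x, f x ^ 3 * fderiv ℝ (fun y => fderiv ℝ f y (𝐞 i)) x (𝐞 i) :=
        integral_finsetSum _ fun i _ => hint1 i
    _ = ∑ i, -∫ x, 3 * (f x ^ 2 * fderiv ℝ f x (𝐞 i) ^ 2) :=
        Finset.sum_congr rfl fun i _ => hIBP i
    _ = -3 * ∑ i, ∫ x, f x ^ 2 * fderiv ℝ f x (𝐞 i) ^ 2 := by
        rw [Finset.mul_sum]
        refine Finset.sum_congr rfl fun i _ => ?_
        rw [integral_const_mul]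
        ring
    _ = -3 * ∫ x, f x ^ 2 * ∑ i, fderiv ℝ f x (𝐞 i) ^ 2 := by
        rw [← integral_finsetSum _ fun i _ => hint2 i]
        congr 1
        refine integral_congr_ae (Eventually.of_forall fun x => ?_)
        show ∑ i, f x ^ 2 * fderiv ℝ f x (𝐞 i) ^ 2 = f x ^ 2 * ∑ i, fderiv ℝ f x (𝐞 i) ^ 2
        rw [Finset.mul_sum]

/-- **Second integration by parts (transport)**: `∫ α̃³ Dα̃[V] = ¼ ∫ D(α̃⁴)[V] = −¼ ∫ α̃⁴ div V = 0`
(`div V = 0` on `𝒞̃`, `α̃(t, ·)` supported inside `𝒞̃`).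
[cite: SereginZajaczkowski2007, proof of Lemma 4.3, (4.16) (the terms V_ϱα̃_{,ϱ} + V₃α̃_{,3})] -/
theorem integral_pow_three_mul_fderiv_velocity (hV : IsSmoothAxisymmetricSolutionOn Q V P)
    {t : ℝ} (ht : t ∈ Ioo (-(2 : ℝ) ^ 2) 0) :
    ∫ x, alphaTilde ψ V t x ^ 3 * fderiv ℝ (alphaTilde ψ V t) x (V t x) = 0 := by
  set f : ℝ³ → ℝ := alphaTilde ψ V t with hf_def
  have hfs : ContDiff ℝ ∞ f := d.contDiff_alphaTilde hV ht
  have hfd : Differentiable ℝ f := hfs.differentiable (by simp)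
  have hfc : Continuous f := hfs.continuous
  have hDc : Continuous fun y => fderiv ℝ f y := hfs.continuous_fderiv (by simp)
  -- the `C¹_c` factor `F = α̃⁴/4`
  set F : ℝ³ → ℝ := fun y => 4⁻¹ * f y ^ 4 with hF_def
  have hF1 : ContDiff ℝ 1 F := contDiff_const.mul ((hfs.of_le (by norm_cast)).pow 4)
  have hcpt4 : HasCompactSupport fun y => f y ^ 4 :=
    d.hasCompactSupport_alphaTilde_pow V t four_ne_zero
  have hFc : HasCompactSupport F := hcpt4.mul_left
  have hFW : tsupport F ⊆ 𝒞 :=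
    (tsupport_mul_subset_right (f := fun _ : ℝ³ => (4 : ℝ)⁻¹) (g := fun y => f y ^ 4)).trans
      ((d.tsupport_alphaTilde_pow_subset V t four_ne_zero).trans d.subset_shell)
  have hF0 : ∀ x ∉ 𝒞, F x = 0 := fun x hx => image_eq_zero_of_notMem_tsupport fun h => hx (hFW h)
  have hF' : ∀ x v, fderiv ℝ F x v = f x ^ 3 * fderiv ℝ f x v := by
    intro x v
    rw [hF_def, (((hfd x).hasFDerivAt.pow 4).const_mul (4 : ℝ)⁻¹).fderiv]
    simp [smul_eq_mul]
    ring
  -- the components `Vⱼ`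
  have hVd : ∀ j, ∀ x ∈ 𝒞, DifferentiableAt ℝ (fun y => V t y j) x := fun j x hx =>
    (contDiffAt_euclidean.1 (hV.contDiffAt_slice ht hx (n := 1)) j).differentiableAt one_ne_zero
  have hVc : ∀ j, ContinuousOn (fun y => V t y j) 𝒞 := fun j x hx =>
    (hVd j x hx).continuousAt.continuousWithinAt
  have hV' : ∀ j, ∀ x ∈ 𝒞, ∀ v, fderiv ℝ (fun y => V t y j) x v = fderiv ℝ (V t) x v j :=
    fun j x hx v => fderiv_coord_apply (hV.differentiableAt_slice ht hx) j v
  have hV'c : ∀ j, ContinuousOn (fun x => fderiv ℝ (fun y => V t y j) x (𝐞 j)) 𝒞 := by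
    intro j
    have hc : ContinuousOn (fun x => fderiv ℝ (V t) x (𝐞 j) j) 𝒞 :=
      (EuclideanSpace.proj j).continuous.comp_continuousOn
        ((hV.continuousOn_fderiv_slice' ht).clm_apply continuousOn_const)
    exact hc.congr fun x hx => hV' j x hx (𝐞 j)
  -- integration by parts for each `j`: `∫ α̃³ ∂ⱼα̃ Vⱼ = ∫ ∂ⱼF Vⱼ = -∫ F ∂ⱼVⱼ`
  have hIBP : ∀ j, ∫ x, f x ^ 3 * fderiv ℝ f x (𝐞 j) * V t x j =
      -∫ x, F x * fderiv ℝ (fun y => V t y j) x (𝐞 j) := by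
    intro j
    rw [integral_mul_fderiv_apply_eq_neg_of_tsupport_subset (isOpen_shell _ _ _) hF1 hFc hFW
      (hVd j) (hVc j) (𝐞 j) (hV'c j), neg_neg]
    exact integral_congr_ae (Eventually.of_forall fun x => by
      show f x ^ 3 * fderiv ℝ f x (𝐞 j) * V t x j = fderiv ℝ F x (𝐞 j) * V t x j
      rw [hF' x (𝐞 j)])
  -- integrability
  have hint1 : ∀ j, Integrable fun x => f x ^ 3 * fderiv ℝ f x (𝐞 j) * V t x j := by
    intro j
    have h := integrable_cutoff_mul (θ := fun y => fderiv ℝ F y (𝐞 j))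
      ((hF1.continuous_fderiv one_ne_zero).clm_apply continuous_const)
      (hFc.fderiv_apply (𝕜 := ℝ) (𝐞 j)) ((tsupport_fderiv_apply_subset ℝ (𝐞 j)).trans hFW) (hVc j)
    refine h.congr (Eventually.of_forall fun x => ?_)
    show fderiv ℝ F x (𝐞 j) * V t x j = f x ^ 3 * fderiv ℝ f x (𝐞 j) * V t x j
    rw [hF' x (𝐞 j)]
  have hint2 : ∀ j, Integrable fun x => F x * fderiv ℝ (fun y => V t y j) x (𝐞 j) := fun j =>
    integrable_cutoff_mul hF1.continuous hFc hFW (hV'c j)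
  -- the divergence: `F Σⱼ ∂ⱼVⱼ = 0` pointwise
  have hdiv : ∀ x, F x * ∑ j, fderiv ℝ (fun y => V t y j) x (𝐞 j) = 0 := by
    intro x
    by_cases hx : x ∈ 𝒞
    · have hsum : ∑ j, fderiv ℝ (fun y => V t y j) x (𝐞 j) = VectorCalculus.divergence (V t) x := by
        rw [divergence_eq_sum_apply]
        exact Finset.sum_congr rfl fun j _ => hV' j x hx (𝐞 j)
      rw [hsum, hV.divergence_slice ht hx, mul_zero]
    · rw [hF0 x hx, zero_mul]
  calc ∫ x, f x ^ 3 * fderiv ℝ f x (V t x)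
      = ∫ x, ∑ j, f x ^ 3 * fderiv ℝ f x (𝐞 j) * V t x j := by
        refine integral_congr_ae (Eventually.of_forall fun x => ?_)
        show f x ^ 3 * fderiv ℝ f x (V t x) = ∑ j, f x ^ 3 * fderiv ℝ f x (𝐞 j) * V t x j
        rw [fderiv_apply_eq_sum f x (V t x), Finset.mul_sum]
        exact Finset.sum_congr rfl fun j _ => by ring
    _ = ∑ j, ∫ x, f x ^ 3 * fderiv ℝ f x (𝐞 j) * V t x j := integral_finsetSum _ fun j _ => hint1 j
    _ = ∑ j, -∫ x, F x * fderiv ℝ (fun y => V t y j) x (𝐞 j) :=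
        Finset.sum_congr rfl fun j _ => hIBP j
    _ = -∫ x, ∑ j, F x * fderiv ℝ (fun y => V t y j) x (𝐞 j) := by
        rw [integral_finsetSum _ fun j _ => hint2 j, Finset.sum_neg_distrib]
    _ = 0 := by
        have h0 : (fun x => ∑ j, F x * fderiv ℝ (fun y => V t y j) x (𝐞 j)) = fun _ => 0 := by
          funext x
          rw [← Finset.mul_sum, hdiv x]
        rw [h0, integral_zero, neg_zero]

/-- `α̃(t, ·)` is an axially symmetric scalar on `ℝ³` (on `𝒞̃` both factors are invariant;
elsewhere it vanishes, and `𝒞̃` is invariant under the rotations). [folklore] -/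
theorem isAxisymmetricScalar_alphaTilde (hV : IsSmoothAxisymmetricSolutionOn Q V P) {t : ℝ}
    (ht : t ∈ Ioo (-(2 : ℝ) ^ 2) 0) : IsAxisymmetricScalar (alphaTilde ψ V t) := by
  intro θ x
  by_cases hx : x ∈ 𝒞
  · rw [alphaTilde, alphaTilde, d.axisymmetric θ t x, swirl_rotZ_of_eq (hV.rotZ_slice ht θ hx)]
  · have hx' : rotZ θ x ∉ 𝒞 := fun h => hx ((rotZ_mem_shell_iff θ).1 h)
    rw [d.alphaTilde_eq_zero V t fun h => hx (d.subset_shell h),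
      d.alphaTilde_eq_zero V t fun h => hx' (d.subset_shell h)]

/-- **Third integration by parts (the radial term)**:
`∫ (2/ϱ) α̃³ ∂_ϱα̃ dx = ¼ ∫ (2/ϱ) ∂_ϱ(α̃⁴) dx = 0`, because `α̃⁴` is an axially symmetric `C¹_c`
scalar vanishing near the axis (the tree's axis integration by parts
`integral_two_div_cylRadius_mul_fderiv_eR`, applied with both functions equal to `α̃²`).
[cite: SereginZajaczkowski2007, proof of Lemma 4.3, (4.16) (the term (2/ϱ)α̃_{,ϱ})] -/
theorem integral_pow_three_mul_radial (hV : IsSmoothAxisymmetricSolutionOn Q V P) {t : ℝ}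
    (ht : t ∈ Ioo (-(2 : ℝ) ^ 2) 0) :
    ∫ x, alphaTilde ψ V t x ^ 3 * (2 / cylRadius x * fderiv ℝ (alphaTilde ψ V t) x (eR x)) = 0 := by
  set f : ℝ³ → ℝ := alphaTilde ψ V t with hf_def
  have hfs : ContDiff ℝ ∞ f := d.contDiff_alphaTilde hV ht
  have hfd : Differentiable ℝ f := hfs.differentiable (by simp)
  have h2 : ContDiff ℝ 1 fun y => f y ^ 2 := (hfs.of_le (by norm_cast)).pow 2
  have hcpt2 : HasCompactSupport fun y => f y ^ 2 :=
    d.hasCompactSupport_alphaTilde_pow V t two_ne_zero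
  have hax : IsAxisymmetricScalar f := d.isAxisymmetricScalar_alphaTilde hV ht
  have hax2 : IsAxisymmetricScalar fun y => f y ^ 2 := fun θ x => by
    show f (rotZ θ x) ^ 2 = f x ^ 2
    rw [hax θ x]
  have hzero : ∀ x, cylRadius x = 0 → f x ^ 2 = 0 := by
    intro x hx
    have hx' : x ∉ 𝒞 := fun h => (cylRadius_pos_of_mem_shell h).ne' hx
    have h0 : f x = 0 := d.alphaTilde_eq_zero V t fun h => hx' (d.subset_shell h)
    rw [h0, zero_pow two_ne_zero]
  have key := integral_two_div_cylRadius_mul_fderiv_eR h2 h2 hcpt2 hax2 hax2 hzero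
  -- the two sides of `key` are the same integral `I`, so `I = 0`; and `I = 2 ×` ours
  have hsame : ∫ x, 2 / cylRadius x * (fderiv ℝ (fun y => f y ^ 2) x (eR x) * f x ^ 2) =
      ∫ x, 2 / cylRadius x * (f x ^ 2 * fderiv ℝ (fun y => f y ^ 2) x (eR x)) :=
    integral_congr_ae (Eventually.of_forall fun x => by
      show 2 / cylRadius x * (fderiv ℝ (fun y => f y ^ 2) x (eR x) * f x ^ 2) =
        2 / cylRadius x * (f x ^ 2 * fderiv ℝ (fun y => f y ^ 2) x (eR x))
      ring)
  have hI0 : ∫ x, 2 / cylRadius x * (f x ^ 2 * fderiv ℝ (fun y => f y ^ 2) x (eR x)) = 0 := by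
    rw [hsame] at key
    linarith
  have hrel : ∫ x, f x ^ 3 * (2 / cylRadius x * fderiv ℝ f x (eR x)) =
      2⁻¹ * ∫ x, 2 / cylRadius x * (f x ^ 2 * fderiv ℝ (fun y => f y ^ 2) x (eR x)) := by
    rw [← integral_const_mul]
    refine integral_congr_ae (Eventually.of_forall fun x => ?_)
    show f x ^ 3 * (2 / cylRadius x * fderiv ℝ f x (eR x)) =
      2⁻¹ * (2 / cylRadius x * (f x ^ 2 * fderiv ℝ (fun y => f y ^ 2) x (eR x)))
    rw [fderiv_pow_apply_eq (hfd x) 2]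
    ring
  rw [hrel, hI0, mul_zero]

/-- **The derivative of `β̃ = α̃²`**: `Dβ̃(t,·)(x) v = 2 α̃ Dα̃ v`. [folklore] -/
theorem fderiv_betaTilde_apply_eq (hV : IsSmoothAxisymmetricSolutionOn Q V P) {t : ℝ}
    (ht : t ∈ Ioo (-(2 : ℝ) ^ 2) 0) (x v : ℝ³) :
    fderiv ℝ (betaTilde ψ V t) x v = 2 * alphaTilde ψ V t x * fderiv ℝ (alphaTilde ψ V t) x v := by
  have hb : betaTilde ψ V t = fun y => alphaTilde ψ V t y ^ 2 := rfl
  rw [hb, fderiv_pow_apply_eq ((d.contDiff_alphaTilde hV ht (n := 1)).differentiable one_ne_zero x) 2]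
  ring

/-- **Dissipation comparison**: `‖∇β̃‖² ≤ 4 α̃² Σᵢ (∂ᵢα̃)²` pointwise. [folklore] -/
theorem norm_fderiv_betaTilde_sq_le (hV : IsSmoothAxisymmetricSolutionOn Q V P) {t : ℝ}
    (ht : t ∈ Ioo (-(2 : ℝ) ^ 2) 0) (x : ℝ³) :
    ‖fderiv ℝ (betaTilde ψ V t) x‖ ^ 2 ≤
      4 * (alphaTilde ψ V t x ^ 2 * ∑ i, (fderiv ℝ (alphaTilde ψ V t) x (𝐞 i)) ^ 2) := by
  refine (opNorm_sq_le_sum_sq _).trans (le_of_eq ?_)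
  rw [Finset.mul_sum, Finset.mul_sum]
  refine Finset.sum_congr rfl fun i _ => ?_
  rw [d.fderiv_betaTilde_apply_eq hV ht]
  ring

/-- The Laplacian of the slices of `ψ` is continuous in `x`. [folklore] -/
theorem continuous_laplacian_slice (t : ℝ) : Continuous fun x => (Δ fun y => ψ (t, y)) x := by
  have hH : ∀ i : Fin 3, Continuous fun x : ℝ³ =>
      fderiv ℝ (fun w => fderiv ℝ ψ w ((0 : ℝ), 𝐞 i)) (t, x) ((0 : ℝ), 𝐞 i) := by
    intro i
    have h1 : ContDiff ℝ 1 fun w => fderiv ℝ ψ w ((0 : ℝ), 𝐞 i) :=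
      (d.contDiff.fderiv_right (m := 1) (by norm_cast)).clm_apply contDiff_const
    exact ((h1.continuous_fderiv one_ne_zero).comp (continuous_const.prodMk continuous_id)).clm_apply
      continuous_const
  have heq : (fun x => (Δ fun y => ψ (t, y)) x) = fun x =>
      ∑ i, fderiv ℝ (fun w => fderiv ℝ ψ w ((0 : ℝ), 𝐞 i)) (t, x) ((0 : ℝ), 𝐞 i) :=
    funext fun x => laplacian_slice_eq_sum d.contDiff t x
  rw [heq]
  exact continuous_finsetSum _ fun i _ => hH i

/-- `x ↦ sliceFDeriv ψ (t, x)` is continuous. [folklore] -/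
theorem continuous_sliceFDeriv_slice (t : ℝ) : Continuous fun x : ℝ³ => sliceFDeriv ψ (t, x) :=
  ((d.contDiff.continuous_fderiv (by simp)).clm_comp continuous_const).comp
    (continuous_const.prodMk continuous_id)

/-- `x ↦ ∂ₜψ(t, x)` is continuous. [folklore] -/
theorem continuous_timeDeriv_slice (t : ℝ) :
    Continuous fun x : ℝ³ => fderiv ℝ ψ (t, x) ((1 : ℝ), (0 : ℝ³)) :=
  ((d.contDiff.continuous_fderiv (by simp)).comp (continuous_const.prodMk continuous_id)).clm_apply
    continuous_const

/-- **The remainder is continuous on `𝒞̃`.** [folklore] -/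
theorem continuousOn_l4Remainder (hV : IsSmoothAxisymmetricSolutionOn Q V P) {t : ℝ}
    (ht : t ∈ Ioo (-(2 : ℝ) ^ 2) 0) : ContinuousOn (l4Remainder ψ V t) 𝒞 := by
  have hsw : ContinuousOn (fun x => swirl (V t) x) 𝒞 :=
    continuousOn_slice_of_continuousOn hV.continuousOn_swirl ht
  have hDsw : ∀ e : ℝ³, ContinuousOn (fun x => fderiv ℝ (swirl (V t)) x e) 𝒞 := fun e =>
    continuousOn_slice_of_continuousOn (hV.continuousOn_fderiv_swirl_apply e) ht
  have hVc : ContinuousOn (V t) 𝒞 := hV.continuousOn_slice ht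
  have hsl := d.continuous_sliceFDeriv_slice t
  have hρ : ContinuousOn (fun x : ℝ³ => 2 / cylRadius x) 𝒞 :=
    continuousOn_const.div continuous_cylRadius.continuousOn fun x hx =>
      (cylRadius_pos_of_mem_shell hx).ne'
  unfold l4Remainder
  refine ((((hsw.mul (d.continuous_timeDeriv_slice t).continuousOn).sub
    (continuousOn_const.mul (continuousOn_finsetSum _ fun i _ =>
      (hsl.clm_apply continuous_const).continuousOn.mul (hDsw (𝐞 i))))).sub
    (hsw.mul (d.continuous_laplacian_slice t).continuousOn)).add
    (hsw.mul (hsl.continuousOn.clm_apply hVc))).add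
    (hρ.mul (hsw.mul (hsl.continuousOn.clm_apply continuousOn_eR_shell)))

/-- Integrability of `α̃ⁿ g` for `g` continuous on `𝒞̃`, `n ≠ 0`. [folklore] -/
theorem integrable_pow_mul (hV : IsSmoothAxisymmetricSolutionOn Q V P) {t : ℝ}
    (ht : t ∈ Ioo (-(2 : ℝ) ^ 2) 0) {n : ℕ} (hn : n ≠ 0) {g : ℝ³ → ℝ} (hg : ContinuousOn g 𝒞) :
    Integrable fun x => alphaTilde ψ V t x ^ n * g x :=
  integrable_cutoff_mul ((d.contDiff_alphaTilde hV ht (n := 0)).continuous.pow n)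
    (d.hasCompactSupport_alphaTilde_pow V t hn)
    ((d.tsupport_alphaTilde_pow_subset V t hn).trans d.subset_shell) hg

/-- **The `L⁴`-energy identity (4.16), integrated form at a fixed time**:
`∫ ∂ₜ(α̃⁴) dx = −12 ∫ α̃² |∇α̃|² dx + 4 ∫ α̃³ R dx` (the printed
`¼ ∂ₜ ∫|α̃|⁴ + ¾ ∫|∇_a(|α̃|²)|² = J₁ + J₂`, times `4`, with `|∇(α̃²)|² = 4α̃²|∇α̃|²`).
[cite: SereginZajaczkowski2007, proof of Lemma 4.3, (4.16)] -/
theorem integral_l4Density_eq (hV : IsSmoothAxisymmetricSolutionOn Q V P) {t : ℝ}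
    (ht : t ∈ Ioo (-(2 : ℝ) ^ 2) 0) :
    ∫ x, l4Density ψ V t x =
      -12 * (∫ x, alphaTilde ψ V t x ^ 2 * ∑ i, (fderiv ℝ (alphaTilde ψ V t) x (𝐞 i)) ^ 2) +
        4 * ∫ x, alphaTilde ψ V t x ^ 3 * l4Remainder ψ V t x := by
  set f : ℝ³ → ℝ := alphaTilde ψ V t with hf_def
  have hfs : ContDiff ℝ ∞ f := d.contDiff_alphaTilde hV ht
  have hfc : Continuous f := hfs.continuous
  have hDc : Continuous fun y => fderiv ℝ f y := hfs.continuous_fderiv (by simp)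
  have hcpt3 : HasCompactSupport fun y => f y ^ 3 :=
    d.hasCompactSupport_alphaTilde_pow V t three_ne_zero
  -- continuity of the Laplacian of `f` (a finite sum of second derivatives)
  have hg : ∀ i, ContDiff ℝ ∞ fun y => fderiv ℝ f y (𝐞 i) := fun i =>
    (hfs.fderiv_right (m := ∞) (by norm_cast)).clm_apply contDiff_const
  have hΔc : Continuous fun x => (Δ f) x := by
    have heq : (fun x => (Δ f) x) = fun x => ∑ i, fderiv ℝ (fun y => fderiv ℝ f y (𝐞 i)) x (𝐞 i) :=
      funext fun x => laplacian_eq_sum_of_contDiffAt ((hfs.of_le (by norm_cast)).contDiffAt)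
    rw [heq]
    exact continuous_finsetSum _ fun i _ =>
      ((hg i).continuous_fderiv (by simp)).clm_apply continuous_const
  -- the four integrable pieces
  have iA : Integrable fun x => f x ^ 3 * (Δ f) x :=
    ((hfc.pow 3).mul hΔc).integrable_of_hasCompactSupport hcpt3.mul_right
  have iB : Integrable fun x => f x ^ 3 * fderiv ℝ f x (V t x) :=
    d.integrable_pow_mul hV ht three_ne_zero
      (hDc.continuousOn.clm_apply (hV.continuousOn_slice ht))
  have iC : Integrable fun x => f x ^ 3 * (2 / cylRadius x * fderiv ℝ f x (eR x)) := by
    refine d.integrable_pow_mul hV ht three_ne_zero ?_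
    exact (continuousOn_const.div continuous_cylRadius.continuousOn fun x hx =>
      (cylRadius_pos_of_mem_shell hx).ne').mul (hDc.continuousOn.clm_apply continuousOn_eR_shell)
  have iD : Integrable fun x => f x ^ 3 * l4Remainder ψ V t x :=
    d.integrable_pow_mul hV ht three_ne_zero (d.continuousOn_l4Remainder hV ht)
  have hpt : (fun x => l4Density ψ V t x) = fun x =>
      4 * (f x ^ 3 * (Δ f) x - f x ^ 3 * fderiv ℝ f x (V t x) -
        f x ^ 3 * (2 / cylRadius x * fderiv ℝ f x (eR x))) + 4 * (f x ^ 3 * l4Remainder ψ V t x) := by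
    funext x
    rw [d.l4Density_eq hV ht x]
    ring
  have iAB : Integrable fun x => f x ^ 3 * (Δ f) x - f x ^ 3 * fderiv ℝ f x (V t x) := iA.sub iB
  have iABC : Integrable fun x => f x ^ 3 * (Δ f) x - f x ^ 3 * fderiv ℝ f x (V t x) -
      f x ^ 3 * (2 / cylRadius x * fderiv ℝ f x (eR x)) := iAB.sub iC
  have i4 : Integrable fun x => 4 * (f x ^ 3 * (Δ f) x - f x ^ 3 * fderiv ℝ f x (V t x) -
      f x ^ 3 * (2 / cylRadius x * fderiv ℝ f x (eR x))) := iABC.const_mul 4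
  have iD4 : Integrable fun x => 4 * (f x ^ 3 * l4Remainder ψ V t x) := iD.const_mul 4
  rw [hpt, integral_add i4 iD4, integral_const_mul, integral_const_mul, integral_sub iAB iC,
    integral_sub iA iB, d.integral_pow_three_mul_laplacian hV ht,
    d.integral_pow_three_mul_fderiv_velocity hV ht, d.integral_pow_three_mul_radial hV ht]
  simp only [hf_def]
  ring

/-- **(4.16) as an inequality with the dissipation `∫ ‖∇β̃‖²`**:
`∫ ∂ₜ(α̃⁴) dx + 3 ∫ ‖∇ₓβ̃‖² dx ≤ 4 ∫ α̃³ R dx` (`‖∇β̃‖² ≤ 4 α̃² Σᵢ(∂ᵢα̃)²`).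
[cite: SereginZajaczkowski2007, proof of Lemma 4.3, (4.16)] -/
theorem integral_l4Density_add_dissipation_le (hV : IsSmoothAxisymmetricSolutionOn Q V P) {t : ℝ}
    (ht : t ∈ Ioo (-(2 : ℝ) ^ 2) 0) :
    (∫ x, l4Density ψ V t x) + 3 * (∫ x, ‖fderiv ℝ (betaTilde ψ V t) x‖ ^ 2) ≤
      4 * ∫ x, alphaTilde ψ V t x ^ 3 * l4Remainder ψ V t x := by
  have hfs : ContDiff ℝ ∞ (alphaTilde ψ V t) := d.contDiff_alphaTilde hV ht
  have hfc : Continuous (alphaTilde ψ V t) := hfs.continuous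
  have hDc : Continuous fun y => fderiv ℝ (alphaTilde ψ V t) y := hfs.continuous_fderiv (by simp)
  have hcpt2 : HasCompactSupport fun y => alphaTilde ψ V t y ^ 2 :=
    d.hasCompactSupport_alphaTilde_pow V t two_ne_zero
  have hb : betaTilde ψ V t = fun y => alphaTilde ψ V t y ^ 2 := rfl
  have hβs : ContDiff ℝ ∞ (betaTilde ψ V t) := by rw [hb]; exact hfs.pow 2
  have hβcpt : HasCompactSupport (betaTilde ψ V t) := by rw [hb]; exact hcpt2
  have hβDcpt : HasCompactSupport fun x => ‖fderiv ℝ (betaTilde ψ V t) x‖ ^ 2 := by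
    refine (hβcpt.fderiv (𝕜 := ℝ)).norm.comp_left (g := fun r : ℝ => r ^ 2) ?_
    norm_num
  have i1 : Integrable fun x => ‖fderiv ℝ (betaTilde ψ V t) x‖ ^ 2 :=
    ((hβs.continuous_fderiv (by simp)).norm.pow 2).integrable_of_hasCompactSupport hβDcpt
  have i2 : Integrable fun x => 4 * (alphaTilde ψ V t x ^ 2 *
      ∑ i, (fderiv ℝ (alphaTilde ψ V t) x (𝐞 i)) ^ 2) :=
    (((hfc.pow 2).mul (continuous_finsetSum _ fun i _ =>
      (hDc.clm_apply continuous_const).pow 2)).integrable_of_hasCompactSupport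
        hcpt2.mul_right).const_mul 4
  have hmono : ∫ x, ‖fderiv ℝ (betaTilde ψ V t) x‖ ^ 2 ≤
      ∫ x, 4 * (alphaTilde ψ V t x ^ 2 * ∑ i, (fderiv ℝ (alphaTilde ψ V t) x (𝐞 i)) ^ 2) :=
    integral_mono i1 i2 fun x => d.norm_fderiv_betaTilde_sq_le hV ht x
  have h4 : ∫ x, 4 * (alphaTilde ψ V t x ^ 2 * ∑ i, (fderiv ℝ (alphaTilde ψ V t) x (𝐞 i)) ^ 2) =
      4 * ∫ x, alphaTilde ψ V t x ^ 2 * ∑ i, (fderiv ℝ (alphaTilde ψ V t) x (𝐞 i)) ^ 2 :=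
    integral_const_mul _ _
  have key := d.integral_l4Density_eq hV ht
  rw [h4] at hmono
  rw [key]
  linarith

/-! ### The pointwise bound for the remainder -/

omit d in
/-- `‖V^a‖ = |V^a|`: the norm of the poloidal part is the poloidal speed (off the axis).
[folklore] -/
theorem norm_poloidalPart_eq_poloidalSpeed (u : ℝ³ → ℝ³) {y : ℝ³} (hy : cylRadius y ≠ 0) :
    ‖poloidalPart u y‖ = poloidalSpeed u y := by
  have h1 := norm_poloidalPart_sq u hy
  have h2 := norm_sq_eq_poloidalSpeed_sq_add_swirlVelocity_sq u hy
  have h3 : ‖poloidalPart u y‖ ^ 2 = poloidalSpeed u y ^ 2 := by rw [h1, h2]; ring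
  exact (sq_eq_sq₀ (norm_nonneg _) (poloidalSpeed_nonneg _ _)).1 h3

omit d in
/-- `|a - b - c + d + e| ≤ |a| + |b| + |c| + |d| + |e|`. [folklore] -/
theorem abs_five_le (a b c e g : ℝ) : |a - b - c + e + g| ≤ |a| + |b| + |c| + |e| + |g| := by
  have h1 := abs_add_le (a - b - c + e) g
  have h2 := abs_add_le (a - b - c) e
  have h3 := abs_sub (a - b) c
  have h4 := abs_sub a b
  linarith

/-- **Axial symmetry kills the swirl component of the transport of `ψ`**: on `𝒞̃`,
`|Dψ(t,·)(x)[V]| ≤ ‖∇ₓψ(t, x)‖ |V^a(x)|` (`Dψ[Jx] = 0` and `V = V^a + (Γ/ϱ²) Jx`).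
[cite: SereginZajaczkowski2007, proof of Lemma 4.3 (J₁: V_ϱψ_{,ϱ} + V₃ψ_{,3} involves V^a only)] -/
theorem abs_sliceFDeriv_velocity_le (V : ℝ → ℝ³ → ℝ³) (t : ℝ) {x : ℝ³} (hx : x ∈ 𝒞) :
    |sliceFDeriv ψ (t, x) (V t x)| ≤ ‖sliceFDeriv ψ (t, x)‖ * poloidalSpeed (V t) x := by
  have hρ : cylRadius x ≠ 0 := (cylRadius_pos_of_mem_shell hx).ne'
  have hJ : sliceFDeriv ψ (t, x) (rotGen x) = 0 := by
    rw [← fderiv_slice_eq_sliceFDeriv d.contDiff]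
    exact (d.isAxisymmetricScalar_slice t).fderiv_rotGen
      ((contDiff_slice' d.contDiff t (n := 1)).differentiable one_ne_zero x)
  have hdec : V t x = poloidalPart (V t) x + (swirl (V t) x / cylRadius x ^ 2) • rotGen x := by
    rw [poloidalPart_eq_sub_smul_rotGen, sub_add_cancel]
  have heq : sliceFDeriv ψ (t, x) (V t x) = sliceFDeriv ψ (t, x) (poloidalPart (V t) x) := by
    conv_lhs => rw [hdec]
    rw [map_add, map_smul, hJ, smul_zero, add_zero]
  rw [heq, ← Real.norm_eq_abs, ← norm_poloidalPart_eq_poloidalSpeed (V t) hρ]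
  exact (sliceFDeriv ψ (t, x)).le_opNorm _

/-- **Pointwise bound for the remainder on the support of the cut-off**: for `x ∈ C` and
`-2² < t < 0`,
`|R| ≤ 9M(|α| + ‖∇α‖) + M |α| |V^a|` (`α = ϱV_φ = swirl`, `M` the slab bound of the cut-off data:
`|α∂ₜψ| ≤ M|α|`, `|2⟪∇ψ,∇α⟫| ≤ 6M‖∇α‖`, `|αΔψ| ≤ M|α|`, `|αDψ[V]| ≤ M|α||V^a|`,
`|(2/ϱ)αDψ[e_ϱ]| ≤ (32/5)M|α|` since `ϱ > 5/16` on `𝒞̃₁ ⊇ C`).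
[cite: SereginZajaczkowski2007, proof of Lemma 4.3 (the estimates of J₁ and J₂)] -/
theorem abs_l4Remainder_le (V : ℝ → ℝ³ → ℝ³) {t : ℝ} (ht : t ∈ Ioo (-(2 : ℝ) ^ 2) 0)
    {x : ℝ³} (hx : x ∈ C) :
    |l4Remainder ψ V t x| ≤
      9 * M * (|swirl (V t) x| + ‖fderiv ℝ (swirl (V t)) x‖) +
        M * (|swirl (V t) x| * poloidalSpeed (V t) x) := by
  have hx𝒞 : x ∈ 𝒞 := d.subset_shell hx
  have hxS : x ∈ S₁ := d.subset hx
  have ht' : t ∈ Icc (-(2 : ℝ) ^ 2) 0 := Ioo_subset_Icc_self ht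
  have hM0 : 0 ≤ M := d.M_nonneg
  set a : ℝ := |swirl (V t) x| with ha
  set Dn : ℝ := ‖fderiv ℝ (swirl (V t)) x‖ with hDn
  set ps : ℝ := poloidalSpeed (V t) x with hps
  set L : ℝ³ →L[ℝ] ℝ := sliceFDeriv ψ (t, x) with hL
  have ha0 : 0 ≤ a := abs_nonneg _
  have hDn0 : 0 ≤ Dn := norm_nonneg _
  have hps0 : 0 ≤ ps := poloidalSpeed_nonneg _ _
  have hLM : ‖L‖ ≤ M := d.norm_sliceFDeriv_le ht' x
  have hρ : 5 / 16 < cylRadius x := (mem_shell.1 hxS).1.1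
  have hρ0 : 0 < cylRadius x := lt_trans (by norm_num) hρ
  -- the five terms
  have h1 : |swirl (V t) x * fderiv ℝ ψ (t, x) ((1 : ℝ), (0 : ℝ³))| ≤ a * M := by
    rw [abs_mul]
    exact mul_le_mul_of_nonneg_left (d.abs_timeDeriv_le ht' x) ha0
  have h2 : |2 * ∑ i, L (𝐞 i) * fderiv ℝ (swirl (V t)) x (𝐞 i)| ≤ 6 * M * Dn := by
    rw [abs_mul, abs_of_pos (by norm_num : (0 : ℝ) < 2)]
    have hterm : ∀ i, |L (𝐞 i) * fderiv ℝ (swirl (V t)) x (𝐞 i)| ≤ M * Dn := by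
      intro i
      rw [abs_mul]
      have hLi : |L (𝐞 i)| ≤ M := by
        rw [← Real.norm_eq_abs]
        refine (L.le_opNorm _).trans ?_
        rw [norm_basisFun_eq_one, mul_one]
        exact hLM
      have hDi : |fderiv ℝ (swirl (V t)) x (𝐞 i)| ≤ Dn := by
        rw [← Real.norm_eq_abs]
        refine ((fderiv ℝ (swirl (V t)) x).le_opNorm _).trans ?_
        rw [norm_basisFun_eq_one, mul_one]
      exact mul_le_mul hLi hDi (abs_nonneg _) hM0
    have hsum : |∑ i, L (𝐞 i) * fderiv ℝ (swirl (V t)) x (𝐞 i)| ≤ 3 * (M * Dn) := by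
      refine (Finset.abs_sum_le_sum_abs _ _).trans ?_
      calc ∑ i, |L (𝐞 i) * fderiv ℝ (swirl (V t)) x (𝐞 i)| ≤ ∑ _i : Fin 3, M * Dn :=
            Finset.sum_le_sum fun i _ => hterm i
        _ = 3 * (M * Dn) := by simp
    linarith
  have h3 : |swirl (V t) x * (Δ fun y => ψ (t, y)) x| ≤ a * M := by
    rw [abs_mul]
    exact mul_le_mul_of_nonneg_left (d.abs_laplacian_le t ht' x) ha0
  have h4 : |swirl (V t) x * L (V t x)| ≤ a * (M * ps) := by
    rw [abs_mul]
    refine mul_le_mul_of_nonneg_left ?_ ha0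
    exact (d.abs_sliceFDeriv_velocity_le V t hx𝒞).trans (mul_le_mul_of_nonneg_right hLM hps0)
  have h5 : |2 / cylRadius x * (swirl (V t) x * L (eR x))| ≤ 32 / 5 * (a * M) := by
    rw [abs_mul, abs_mul, abs_of_pos (by positivity : (0 : ℝ) < 2 / cylRadius x)]
    have hq : 2 / cylRadius x ≤ 32 / 5 := by
      rw [div_le_iff₀ hρ0]
      linarith
    have hLe : |L (eR x)| ≤ M := by
      rw [← Real.norm_eq_abs]
      refine (L.le_opNorm _).trans ?_
      rw [norm_eR_eq_one hρ0.ne', mul_one]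
      exact hLM
    have hprod : a * |L (eR x)| ≤ a * M := mul_le_mul_of_nonneg_left hLe ha0
    calc 2 / cylRadius x * (a * |L (eR x)|) ≤ 32 / 5 * (a * |L (eR x)|) :=
          mul_le_mul_of_nonneg_right hq (by positivity)
      _ ≤ 32 / 5 * (a * M) := by gcongr
  have htri := abs_five_le (swirl (V t) x * fderiv ℝ ψ (t, x) ((1 : ℝ), (0 : ℝ³)))
    (2 * ∑ i, L (𝐞 i) * fderiv ℝ (swirl (V t)) x (𝐞 i))
    (swirl (V t) x * (Δ fun y => ψ (t, y)) x) (swirl (V t) x * L (V t x))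
    (2 / cylRadius x * (swirl (V t) x * L (eR x)))
  have hR : l4Remainder ψ V t x =
      swirl (V t) x * fderiv ℝ ψ (t, x) ((1 : ℝ), (0 : ℝ³)) -
        2 * ∑ i, L (𝐞 i) * fderiv ℝ (swirl (V t)) x (𝐞 i) -
        swirl (V t) x * (Δ fun y => ψ (t, y)) x + swirl (V t) x * L (V t x) +
        2 / cylRadius x * (swirl (V t) x * L (eR x)) := rfl
  rw [hR]
  nlinarith [mul_nonneg hM0 ha0, mul_nonneg hM0 hDn0]

end SwirlCutoffData

end Identity



end SereginZajaczkowski2007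

end Literature.Analysis.FluidPDE
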